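import Summits.QuantumFields.YangMills.Theorems.FluctuationComparisonRegPrIntLOrganTangentTelescopeWindowPath
import HarnessLib

/-!
# Crux `FluctuationComparisonRegPrIntL` (stmt-QuantumFields-20520, rung R3), PATH-B organ, v18 (H-currency): BRICK 2a —
# THE PULL-BACK OF AN H-CLAUSE ALONG DISPLACEMENT PATHS (the CLASSICAL skeleton of LINᵘ-H's transport; abstract, DEFINITION-FREE)

Cell `ym3-torus` (YM ladder rung R3 = continuum `SU(2)` Yang–Mills on the three-torus — a RUNG: NOT d = 4, NOT infinite volume, NOT a mass gap, NOT Clay).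
LEAD-20520 width seat `ym-ust-20520-w3` (gen 25), BRICK 2a of the O1ᵘ-H v2 reduction (LEAD WORD №3 02:45Z; w5 g22 FINDING §6 «chart-response gain» adopted: the
m-uniform transport is a SPREAD fibre transport with displacement paths of full, overlapping support — NOT a derivative along the landed central-bond charts);
`--kind proof --supports stmt-QuantumFields-20520 --as helper`, count-neutral, no registry ∕ binder ∕ `Lines/` edit, default heartbeats, `autoImplicit false`.

WHAT THIS IS.  Brick T (✓p797413 `…OrganTangentTelescopeWindowPath`, ideator g26 ∕ LEAD w3 g24) transports FIRST differences along ONE path; px20 g17's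
«bilinear telescope» (✓∕⧗ `…OrganTangentTelescopeWindowPathMixed` + its path-level-conjugation follow-up, LEAD №4 docking spec) bounds the SECOND difference of `f`
over a BASE path `P` and a TOP path `Q` by the bilinear letter sum `C·Σ_{(a,m)∈P} Σ_{(c,n)∈Q} k a c·sz m·sz n`.  THIS FILE is the next layer, in brick T's ABSTRACT
setting (`act : X → ι → M → X`, sizes `sz`, a function `f`, pair letters `k`, gradient letters `g`): a map `T : Xc → X` from a COARSE move system
(`actc : Xc → ιc → Mc → Xc`) whose coarse one-move response is REALISED BY DISPLACEMENT PATHS — `hE : (E V B m)·(T V) = T (V·m@B)` (first order) and, for a coarse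
SQUARE, a CORRECTION path from the composed first-order corner to the true corner, `hCorr : (Corr V B m B′ m′)·((E V B′ m′)·((E V B m)·(T V))) = T (V·m@B·m′@B′)`
(second order) — PULLS BACK the pair clause: ★★`secondDiff_pullback`
`|f (T V₁₁) − f (T V₁₀) − f (T V₀₁) + f (T V₀₀)| ≤ C·Σ_{(a,m)∈E V B m} Σ_{(c,n)∈E V B′ m′} k a c·sz m·sz n + Σ_{(d,u)∈Corr} g d·sz u`,
from the bilinear bound `hT2` (carried as a HYPOTHESIS in exactly px20's conclusion shape — discharged by their theorem on landing) and the gradient clause `hG`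
telescoped along `Corr` (§1 `firstDiff_path_of_gradient`).  §3 regroups the path sums by bond (`list_sum_eq_sum_fiber`) and gives the COARSE LETTERS
★`secondDiff_pullback_letters`: with column letters `Σ_{(a,m)∈E V B m, a = a₀} sz m ≤ X a₀ B·szc m` and `Σ_{(d,u)∈Corr, d = d₀} sz u ≤ Y d₀ B B′·szc m·szc m′`,
`|ΔΔ (f ∘ T)| ≤ (C·Σ_{a₀ c₀} X a₀ B·k a₀ c₀·X c₀ B′ + Σ_{d₀} g d₀·Y d₀ B B′)·szc m·szc m′` — i.e. the coarse pair letters are `k_c = C·Xᵀ k X + gᵀ Y`.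
WINDOWED editions (`_on`: clause∕gradient only on `Good` configurations with sizes `≤ ρ`, every grid ∕ prefix configuration `Good`) are §2′.

WHERE IT SITS.  LINᵘ-H (BRICK 1 ✓p804070's `hL`) presents the m-step fibre mean `mfun(V) = E_{P_V}[h_{Ts}]`; along a fibre-respecting spread transport `T_{V}` (w5 §6.4)
`Δ² mfun` = E[Δ²(h∘T)] (THIS FILE, per fibre point) + measure-variation terms (RN ∕ weight-response ∕ oscillation letters — NOT here; ideator №11's design question).
The DISPLACEMENT DATA `(E, Corr)` with column letters `(X, Y)` is the shape in which [Balaban1985Variational] Thm 1 p.279 ∕ Prop 9 p.309 (190) (lit `B11.Thm1Printed`,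
`B11.Prop9Printed`, `B11Ineq190Actual`) and [Balaban1984PropagatorsI] Prop 1.2 p.35 would enter: `X a₀ B ≲ e^{−δ₀·dist(a₀,B)}` m-uniformly (FL-20′'s `N_∞`).

HONEST FRAMING: telescoping algebra over HYPOTHESIS clauses (triangle inequality, list inductions, a Finset regrouping); nothing of Bałaban's analysis is asserted
or proved; the displacement data for the runs' towers are NOT constructed here; LINᵘ-H ∕ JENᵘ-H ∕ O1ᵘ-H v2 ∕ S1aᴴ ∕ 26243 ∕ S2α′ ∕ S2β OPEN; crux 20520
`FluctuationComparisonRegPrIntL` ∕ `YM3TorusSU2` NOT proved; no summit ∕ sub-problem statement is proved; rung R3 = SU(2) YM₃ on T³ at fixed lattice data — NOT d = 4,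
NOT infinite volume, NOT a mass gap, NOT Clay; the Yang–Mills mass gap is NOT proved.  [folklore] bookkeeping; LOCATE: none in print beyond the shape remarks above.
-/

set_option autoImplicit false

noncomputable section

namespace Summit.QuantumFields.YangMills.Theorems.OrganTangentPullbackSquare

open scoped BigOperators

variable {X ι M Xc ιc Mc : Type*}

/-! ## §1 First differences along a path from UNIFORM gradient letters -/

/-- Telescoping first differences along a path of moves with uniform gradient letters `g`. [folklore] -/
theorem firstDiff_path_of_gradient (act : X → ι → M → X) (sz : M → ℝ) (f : X → ℝ) (g : ι → ℝ)
    (hG : ∀ (Y : X) (b : ι) (n : M), |f (act Y b n) - f Y| ≤ g b * sz n) :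
    ∀ (c : List (ι × M)) (Y : X),
      |f (c.foldl (fun V p => act V p.1 p.2) Y) - f Y| ≤ (c.map (fun p => g p.1 * sz p.2)).sum := by
  intro c
  induction c with
  | nil => intro Y; simp
  | cons p ps ih =>
    intro Y
    rw [List.foldl_cons, List.map_cons, List.sum_cons]
    have h1 := hG Y p.1 p.2
    have h2 := ih (act Y p.1 p.2)
    calc |f (ps.foldl (fun V p => act V p.1 p.2) (act Y p.1 p.2)) - f Y|
          = |(f (ps.foldl (fun V p => act V p.1 p.2) (act Y p.1 p.2)) - f (act Y p.1 p.2)) + (f (act Y p.1 p.2) - f Y)| := by ring_nf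
      _ ≤ |f (ps.foldl (fun V p => act V p.1 p.2) (act Y p.1 p.2)) - f (act Y p.1 p.2)| + |f (act Y p.1 p.2) - f Y| := abs_add_le _ _
      _ ≤ (ps.map (fun p => g p.1 * sz p.2)).sum + g p.1 * sz p.2 := add_le_add h2 h1
      _ = g p.1 * sz p.2 + (ps.map (fun p => g p.1 * sz p.2)).sum := add_comm _ _

/-- WINDOWED edition: gradient letters only at `Good` configurations and for moves of size `≤ ρ`; every proper prefix of the path must be `Good`. [folklore] -/
theorem firstDiff_path_of_gradient_on (Good : X → Prop) (ρ : ℝ) (act : X → ι → M → X) (sz : M → ℝ) (f : X → ℝ) (g : ι → ℝ)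
    (hG : ∀ (Y : X) (b : ι) (n : M), Good Y → sz n ≤ ρ → |f (act Y b n) - f Y| ≤ g b * sz n) :
    ∀ (c : List (ι × M)) (Y : X),
      (∀ i, i < c.length → Good ((c.take i).foldl (fun V p => act V p.1 p.2) Y)) →
      (∀ p ∈ c, sz p.2 ≤ ρ) →
      |f (c.foldl (fun V p => act V p.1 p.2) Y) - f Y| ≤ (c.map (fun p => g p.1 * sz p.2)).sum := by
  intro c
  induction c with
  | nil => intro Y _ _; simp
  | cons p ps ih =>
    intro Y hgood hsz
    rw [List.foldl_cons, List.map_cons, List.sum_cons]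
    have hY : Good Y := by simpa using hgood 0 (by simp)
    have h1 := hG Y p.1 p.2 hY (hsz p (by simp))
    have h2 := ih (act Y p.1 p.2) (fun i hi => by
      have := hgood (i + 1) (by simpa using hi)
      simpa [List.take_succ_cons, List.foldl_cons] using this) (fun q hq => hsz q (List.mem_cons_of_mem _ hq))
    calc |f (ps.foldl (fun V p => act V p.1 p.2) (act Y p.1 p.2)) - f Y|
          = |(f (ps.foldl (fun V p => act V p.1 p.2) (act Y p.1 p.2)) - f (act Y p.1 p.2)) + (f (act Y p.1 p.2) - f Y)| := by ring_nf
      _ ≤ |f (ps.foldl (fun V p => act V p.1 p.2) (act Y p.1 p.2)) - f (act Y p.1 p.2)| + |f (act Y p.1 p.2) - f Y| := abs_add_le _ _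
      _ ≤ (ps.map (fun p => g p.1 * sz p.2)).sum + g p.1 * sz p.2 := add_le_add h2 h1
      _ = g p.1 * sz p.2 + (ps.map (fun p => g p.1 * sz p.2)).sum := add_comm _ _

/-! ## §2 The pull-back of the pair clause along displacement paths -/

/-- ★★ **PULL-BACK OF THE PAIR CLAUSE ALONG DISPLACEMENT PATHS** (see the module docstring): the coarse square's second difference of `f ∘ T` is the bilinear
telescope over the two first-order displacement paths (hypothesis `hT2`, px20 g17's theorem shape: base path first, top path second, letters `k (base) (top)`)
plus the gradient telescope along the second-order correction path. [folklore] -/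
theorem secondDiff_pullback (act : X → ι → M → X) (sz : M → ℝ) (f : X → ℝ) (k : ι → ι → ℝ) (g : ι → ℝ) (C : ℝ)
    (actc : Xc → ιc → Mc → Xc) (T : Xc → X) (E : Xc → ιc → Mc → List (ι × M)) (Corr : Xc → ιc → Mc → ιc → Mc → List (ι × M))
    (hT2 : ∀ (Y : X) (P Q : List (ι × M)),
      |f (Q.foldl (fun V p => act V p.1 p.2) (P.foldl (fun V p => act V p.1 p.2) Y)) - f (P.foldl (fun V p => act V p.1 p.2) Y)
          - f (Q.foldl (fun V p => act V p.1 p.2) Y) + f Y|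
        ≤ C * (P.map (fun a => (Q.map (fun c => k a.1 c.1 * sz a.2 * sz c.2)).sum)).sum)
    (hG : ∀ (Y : X) (b : ι) (n : M), |f (act Y b n) - f Y| ≤ g b * sz n)
    (hE : ∀ (V : Xc) (B : ιc) (m : Mc), (E V B m).foldl (fun V p => act V p.1 p.2) (T V) = T (actc V B m))
    (hCorr : ∀ (V : Xc) (B : ιc) (m : Mc) (B' : ιc) (m' : Mc),
      (Corr V B m B' m').foldl (fun V p => act V p.1 p.2)
          ((E V B' m').foldl (fun V p => act V p.1 p.2) ((E V B m).foldl (fun V p => act V p.1 p.2) (T V))) =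
        T (actc (actc V B m) B' m'))
    (V : Xc) (B B' : ιc) (m m' : Mc) :
    |f (T (actc (actc V B m) B' m')) - f (T (actc V B m)) - f (T (actc V B' m')) + f (T V)|
      ≤ C * ((E V B m).map (fun a => ((E V B' m').map (fun c => k a.1 c.1 * sz a.2 * sz c.2)).sum)).sum
        + ((Corr V B m B' m').map (fun p => g p.1 * sz p.2)).sum := by
  have h10 := hE V B m
  have h01 := hE V B' m'
  have h11 := hCorr V B m B' m'
  set Y := T V with hY
  set P := E V B m with hP
  set Q := E V B' m' with hQ
  set Cr := Corr V B m B' m' with hCr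
  set PY := P.foldl (fun V p => act V p.1 p.2) Y with hPY
  set QY := Q.foldl (fun V p => act V p.1 p.2) Y with hQY
  set QPY := Q.foldl (fun V p => act V p.1 p.2) PY with hQPY
  rw [← h11, ← h10, ← h01]
  have hbil := hT2 Y P Q
  have hgrad := firstDiff_path_of_gradient act sz f g hG Cr QPY
  have hsplit : f (Cr.foldl (fun V p => act V p.1 p.2) QPY) - f PY - f QY + f Y
      = (f (Cr.foldl (fun V p => act V p.1 p.2) QPY) - f QPY) + (f QPY - f PY - f QY + f Y) := by ring
  rw [hsplit]
  calc |(f (Cr.foldl (fun V p => act V p.1 p.2) QPY) - f QPY) + (f QPY - f PY - f QY + f Y)|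
        ≤ |f (Cr.foldl (fun V p => act V p.1 p.2) QPY) - f QPY| + |f QPY - f PY - f QY + f Y| := abs_add_le _ _
    _ ≤ (Cr.map (fun p => g p.1 * sz p.2)).sum + C * (P.map (fun a => (Q.map (fun c => k a.1 c.1 * sz a.2 * sz c.2)).sum)).sum :=
        add_le_add hgrad hbil
    _ = C * (P.map (fun a => (Q.map (fun c => k a.1 c.1 * sz a.2 * sz c.2)).sum)).sum + (Cr.map (fun p => g p.1 * sz p.2)).sum := add_comm _ _

/-! ## §2′ Windowed edition -/

/-- ★★ WINDOWED PULL-BACK: the bilinear bound and the gradient letters are assumed only on `Good` data with move sizes `≤ ρ` (base-path moves `C·sz ≤ ρ`, as the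
conjugated telescope requires); every grid configuration `(Q.take l)·((P.take i)·(T V))` and every proper prefix of the correction path over the composed corner
must be `Good`. [folklore] -/
theorem secondDiff_pullback_on (Good : X → Prop) (ρ : ℝ) (act : X → ι → M → X) (sz : M → ℝ) (f : X → ℝ) (k : ι → ι → ℝ) (g : ι → ℝ) (C : ℝ)
    (actc : Xc → ιc → Mc → Xc) (T : Xc → X) (E : Xc → ιc → Mc → List (ι × M)) (Corr : Xc → ιc → Mc → ιc → Mc → List (ι × M))
    (hT2 : ∀ (Y : X) (P Q : List (ι × M)),
      (∀ a ∈ P, C * sz a.2 ≤ ρ) → (∀ c ∈ Q, sz c.2 ≤ ρ) →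
      (∀ i l, i ≤ P.length → l ≤ Q.length →
        Good ((Q.take l).foldl (fun V p => act V p.1 p.2) ((P.take i).foldl (fun V p => act V p.1 p.2) Y))) →
      |f (Q.foldl (fun V p => act V p.1 p.2) (P.foldl (fun V p => act V p.1 p.2) Y)) - f (P.foldl (fun V p => act V p.1 p.2) Y)
          - f (Q.foldl (fun V p => act V p.1 p.2) Y) + f Y|
        ≤ C * (P.map (fun a => (Q.map (fun c => k a.1 c.1 * sz a.2 * sz c.2)).sum)).sum)
    (hG : ∀ (Y : X) (b : ι) (n : M), Good Y → sz n ≤ ρ → |f (act Y b n) - f Y| ≤ g b * sz n)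
    (hE : ∀ (V : Xc) (B : ιc) (m : Mc), (E V B m).foldl (fun V p => act V p.1 p.2) (T V) = T (actc V B m))
    (hCorr : ∀ (V : Xc) (B : ιc) (m : Mc) (B' : ιc) (m' : Mc),
      (Corr V B m B' m').foldl (fun V p => act V p.1 p.2)
          ((E V B' m').foldl (fun V p => act V p.1 p.2) ((E V B m).foldl (fun V p => act V p.1 p.2) (T V))) =
        T (actc (actc V B m) B' m'))
    (V : Xc) (B B' : ιc) (m m' : Mc)
    (hszP : ∀ a ∈ E V B m, C * sz a.2 ≤ ρ) (hszQ : ∀ c ∈ E V B' m', sz c.2 ≤ ρ) (hszC : ∀ d ∈ Corr V B m B' m', sz d.2 ≤ ρ)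
    (hgrid : ∀ i l, i ≤ (E V B m).length → l ≤ (E V B' m').length →
      Good (((E V B' m').take l).foldl (fun V p => act V p.1 p.2) (((E V B m).take i).foldl (fun V p => act V p.1 p.2) (T V))))
    (hcorr : ∀ i, i < (Corr V B m B' m').length →
      Good (((Corr V B m B' m').take i).foldl (fun V p => act V p.1 p.2)
        ((E V B' m').foldl (fun V p => act V p.1 p.2) ((E V B m).foldl (fun V p => act V p.1 p.2) (T V))))) :
    |f (T (actc (actc V B m) B' m')) - f (T (actc V B m)) - f (T (actc V B' m')) + f (T V)|
      ≤ C * ((E V B m).map (fun a => ((E V B' m').map (fun c => k a.1 c.1 * sz a.2 * sz c.2)).sum)).sum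
        + ((Corr V B m B' m').map (fun p => g p.1 * sz p.2)).sum := by
  have h10 := hE V B m
  have h01 := hE V B' m'
  have h11 := hCorr V B m B' m'
  set Y := T V with hY
  set P := E V B m with hP
  set Q := E V B' m' with hQ
  set Cr := Corr V B m B' m' with hCr
  set PY := P.foldl (fun V p => act V p.1 p.2) Y with hPY
  set QY := Q.foldl (fun V p => act V p.1 p.2) Y with hQY
  set QPY := Q.foldl (fun V p => act V p.1 p.2) PY with hQPY
  rw [← h11, ← h10, ← h01]
  have hbil := hT2 Y P Q hszP hszQ hgrid
  have hgrad := firstDiff_path_of_gradient_on Good ρ act sz f g hG Cr QPY hcorr hszC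
  have hsplit : f (Cr.foldl (fun V p => act V p.1 p.2) QPY) - f PY - f QY + f Y
      = (f (Cr.foldl (fun V p => act V p.1 p.2) QPY) - f QPY) + (f QPY - f PY - f QY + f Y) := by ring
  rw [hsplit]
  calc |(f (Cr.foldl (fun V p => act V p.1 p.2) QPY) - f QPY) + (f QPY - f PY - f QY + f Y)|
        ≤ |f (Cr.foldl (fun V p => act V p.1 p.2) QPY) - f QPY| + |f QPY - f PY - f QY + f Y| := abs_add_le _ _
    _ ≤ (Cr.map (fun p => g p.1 * sz p.2)).sum + C * (P.map (fun a => (Q.map (fun c => k a.1 c.1 * sz a.2 * sz c.2)).sum)).sum :=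
        add_le_add hgrad hbil
    _ = C * (P.map (fun a => (Q.map (fun c => k a.1 c.1 * sz a.2 * sz c.2)).sum)).sum + (Cr.map (fun p => g p.1 * sz p.2)).sum := add_comm _ _

/-! ## §3 Regrouping the path sums by bond: the coarse letters `k_c = C·Xᵀ k X + gᵀ Y` -/

/-- A list sum regrouped over the fibres of the bond projection. [folklore] -/
theorem list_sum_eq_sum_fiber [Fintype ι] [DecidableEq ι] (P : List (ι × M)) (φ : ι × M → ℝ) :
    (P.map φ).sum = ∑ a₀ : ι, ((P.filter (fun p => decide (p.1 = a₀))).map φ).sum := by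
  induction P with
  | nil => simp
  | cons p ps ih =>
    rw [List.map_cons, List.sum_cons, ih]
    have key : ∀ a₀ : ι, (((p :: ps).filter (fun q => decide (q.1 = a₀))).map φ).sum
        = (if p.1 = a₀ then φ p else 0) + ((ps.filter (fun q => decide (q.1 = a₀))).map φ).sum := by
      intro a₀
      by_cases h : p.1 = a₀
      · rw [List.filter_cons_of_pos (by simpa using h), List.map_cons, List.sum_cons, if_pos h]
      · rw [List.filter_cons_of_neg (by simpa using h), if_neg h, zero_add]
    simp_rw [key]
    rw [Finset.sum_add_distrib, Finset.sum_ite_eq Finset.univ p.1 (fun _ => φ p)]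
    simp

/-- The bilinear path sum regrouped by bonds and bounded by COLUMN letters: with `colSz P a₀ := Σ_{(a,m)∈P, a = a₀} sz m ≤ xP a₀` and likewise `≤ xQ c₀`,
`Σ_{(a,m)∈P} Σ_{(c,n)∈Q} k a c·sz m·sz n ≤ Σ_{a₀ c₀} k a₀ c₀·xP a₀·xQ c₀` (`k, sz ≥ 0`). [folklore] -/
theorem bilinear_pathSum_le [Fintype ι] [DecidableEq ι] (sz : M → ℝ) (k : ι → ι → ℝ) (hk : ∀ a c, 0 ≤ k a c) (hsz : ∀ n, 0 ≤ sz n)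
    (P Q : List (ι × M)) (xP xQ : ι → ℝ)
    (hP : ∀ a₀, ((P.filter (fun p => decide (p.1 = a₀))).map (fun p => sz p.2)).sum ≤ xP a₀)
    (hQ : ∀ c₀, ((Q.filter (fun p => decide (p.1 = c₀))).map (fun p => sz p.2)).sum ≤ xQ c₀) :
    (P.map (fun a => (Q.map (fun c => k a.1 c.1 * sz a.2 * sz c.2)).sum)).sum ≤ ∑ a₀ : ι, ∑ c₀ : ι, k a₀ c₀ * xP a₀ * xQ c₀ := by
  -- inner regrouping: for a fixed base bond `a₀` and size `s ≥ 0`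
  have inner : ∀ (a₀ : ι) (s : ℝ), 0 ≤ s →
      (Q.map (fun c => k a₀ c.1 * s * sz c.2)).sum ≤ ∑ c₀ : ι, k a₀ c₀ * s * xQ c₀ := by
    intro a₀ s hs
    rw [list_sum_eq_sum_fiber Q (fun c => k a₀ c.1 * s * sz c.2)]
    refine Finset.sum_le_sum (fun c₀ _ => ?_)
    have hrew : ((Q.filter (fun p => decide (p.1 = c₀))).map (fun c => k a₀ c.1 * s * sz c.2)).sum
        = k a₀ c₀ * s * ((Q.filter (fun p => decide (p.1 = c₀))).map (fun p => sz p.2)).sum := by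
      rw [← List.sum_map_mul_left]
      congr 1
      refine List.map_congr_left (fun c hc => ?_)
      have hc1 : c.1 = c₀ := by simpa using (List.mem_filter.1 hc).2
      rw [hc1]
    rw [hrew]
    exact mul_le_mul_of_nonneg_left (hQ c₀) (mul_nonneg (hk _ _) hs)
  -- outer regrouping
  have hxQ : ∀ c₀, 0 ≤ xQ c₀ := fun c₀ => le_trans (List.sum_nonneg (by
    intro x hx
    obtain ⟨p, _, rfl⟩ := List.mem_map.1 hx
    exact hsz _)) (hQ c₀)
  calc (P.map (fun a => (Q.map (fun c => k a.1 c.1 * sz a.2 * sz c.2)).sum)).sum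
      ≤ (P.map (fun a => ∑ c₀ : ι, k a.1 c₀ * sz a.2 * xQ c₀)).sum := by
        refine List.sum_le_sum (fun a _ => inner a.1 (sz a.2) (hsz _))
    _ = ∑ a₀ : ι, ((P.filter (fun p => decide (p.1 = a₀))).map (fun a => ∑ c₀ : ι, k a.1 c₀ * sz a.2 * xQ c₀)).sum :=
        list_sum_eq_sum_fiber P _
    _ ≤ ∑ a₀ : ι, ∑ c₀ : ι, k a₀ c₀ * xP a₀ * xQ c₀ := by
        refine Finset.sum_le_sum (fun a₀ _ => ?_)
        have hrew : ((P.filter (fun p => decide (p.1 = a₀))).map (fun a => ∑ c₀ : ι, k a.1 c₀ * sz a.2 * xQ c₀)).sum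
            = ((P.filter (fun p => decide (p.1 = a₀))).map (fun a => (∑ c₀ : ι, k a₀ c₀ * xQ c₀) * sz a.2)).sum := by
          congr 1
          refine List.map_congr_left (fun a ha => ?_)
          have ha1 : a.1 = a₀ := by simpa using (List.mem_filter.1 ha).2
          rw [ha1, Finset.sum_mul]
          exact Finset.sum_congr rfl (fun c₀ _ => by ring)
        rw [hrew, List.sum_map_mul_left]
        have hS : 0 ≤ ∑ c₀ : ι, k a₀ c₀ * xQ c₀ := Finset.sum_nonneg (fun c₀ _ => mul_nonneg (hk _ _) (hxQ c₀))
        calc (∑ c₀ : ι, k a₀ c₀ * xQ c₀) * ((P.filter (fun p => decide (p.1 = a₀))).map (fun a => sz a.2)).sum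
            ≤ (∑ c₀ : ι, k a₀ c₀ * xQ c₀) * xP a₀ := mul_le_mul_of_nonneg_left (hP a₀) hS
          _ = ∑ c₀ : ι, k a₀ c₀ * xP a₀ * xQ c₀ := by rw [Finset.sum_mul]; exact Finset.sum_congr rfl (fun c₀ _ => by ring)

/-- The gradient path sum regrouped by bonds: `Σ_{(d,u)∈Cr} g d·sz u ≤ Σ_{d₀} g d₀·y d₀` when `colSz Cr d₀ ≤ y d₀` (`g, sz ≥ 0`). [folklore] -/
theorem gradient_pathSum_le [Fintype ι] [DecidableEq ι] (sz : M → ℝ) (g : ι → ℝ) (hg : ∀ d, 0 ≤ g d)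
    (Cr : List (ι × M)) (y : ι → ℝ)
    (hC : ∀ d₀, ((Cr.filter (fun p => decide (p.1 = d₀))).map (fun p => sz p.2)).sum ≤ y d₀) :
    (Cr.map (fun p => g p.1 * sz p.2)).sum ≤ ∑ d₀ : ι, g d₀ * y d₀ := by
  rw [list_sum_eq_sum_fiber Cr (fun p => g p.1 * sz p.2)]
  refine Finset.sum_le_sum (fun d₀ _ => ?_)
  have hrew : ((Cr.filter (fun p => decide (p.1 = d₀))).map (fun p => g p.1 * sz p.2)).sum
      = g d₀ * ((Cr.filter (fun p => decide (p.1 = d₀))).map (fun p => sz p.2)).sum := by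
    rw [← List.sum_map_mul_left]
    congr 1
    refine List.map_congr_left (fun p hp => ?_)
    have hp1 : p.1 = d₀ := by simpa using (List.mem_filter.1 hp).2
    rw [hp1]
  rw [hrew]
  exact mul_le_mul_of_nonneg_left (hC d₀) (hg d₀)

/-- ★ **THE COARSE LETTERS**: pull-back (§2) + regrouping (§3) ⟹ `|ΔΔ (f ∘ T)| ≤ (C·Σ_{a₀ c₀} k a₀ c₀·X a₀ B·X c₀ B′ + Σ_{d₀} g d₀·Y d₀ B B′)·szc m·szc m′` from
column letters `X` (first order) and `Y` (second order) of the displacement data — the coarse pair letters are `k_c B B′ := C·(Xᵀ k X)_{B B′} + (gᵀ Y)_{B B′}`. [folklore] -/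
theorem secondDiff_pullback_letters [Fintype ι] [DecidableEq ι]
    (act : X → ι → M → X) (sz : M → ℝ) (f : X → ℝ) (k : ι → ι → ℝ) (g : ι → ℝ) (C : ℝ)
    (hk : ∀ a c, 0 ≤ k a c) (hg : ∀ d, 0 ≤ g d) (hsz : ∀ n, 0 ≤ sz n) (hC : 0 ≤ C)
    (actc : Xc → ιc → Mc → Xc) (szc : Mc → ℝ) (T : Xc → X)
    (E : Xc → ιc → Mc → List (ι × M)) (Corr : Xc → ιc → Mc → ιc → Mc → List (ι × M))
    (Xl : ι → ιc → ℝ) (Yl : ι → ιc → ιc → ℝ)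
    (hT2 : ∀ (Y : X) (P Q : List (ι × M)),
      |f (Q.foldl (fun V p => act V p.1 p.2) (P.foldl (fun V p => act V p.1 p.2) Y)) - f (P.foldl (fun V p => act V p.1 p.2) Y)
          - f (Q.foldl (fun V p => act V p.1 p.2) Y) + f Y|
        ≤ C * (P.map (fun a => (Q.map (fun c => k a.1 c.1 * sz a.2 * sz c.2)).sum)).sum)
    (hG : ∀ (Y : X) (b : ι) (n : M), |f (act Y b n) - f Y| ≤ g b * sz n)
    (hE : ∀ (V : Xc) (B : ιc) (m : Mc), (E V B m).foldl (fun V p => act V p.1 p.2) (T V) = T (actc V B m))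
    (hCorr : ∀ (V : Xc) (B : ιc) (m : Mc) (B' : ιc) (m' : Mc),
      (Corr V B m B' m').foldl (fun V p => act V p.1 p.2)
          ((E V B' m').foldl (fun V p => act V p.1 p.2) ((E V B m).foldl (fun V p => act V p.1 p.2) (T V))) =
        T (actc (actc V B m) B' m'))
    (hX : ∀ (V : Xc) (B : ιc) (m : Mc) (a₀ : ι),
      (((E V B m).filter (fun p => decide (p.1 = a₀))).map (fun p => sz p.2)).sum ≤ Xl a₀ B * szc m)
    (hY : ∀ (V : Xc) (B : ιc) (m : Mc) (B' : ιc) (m' : Mc) (d₀ : ι),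
      (((Corr V B m B' m').filter (fun p => decide (p.1 = d₀))).map (fun p => sz p.2)).sum ≤ Yl d₀ B B' * szc m * szc m')
    (V : Xc) (B B' : ιc) (m m' : Mc) :
    |f (T (actc (actc V B m) B' m')) - f (T (actc V B m)) - f (T (actc V B' m')) + f (T V)|
      ≤ (C * ∑ a₀ : ι, ∑ c₀ : ι, Xl a₀ B * k a₀ c₀ * Xl c₀ B' + ∑ d₀ : ι, g d₀ * Yl d₀ B B') * szc m * szc m' := by
  have h := secondDiff_pullback act sz f k g C actc T E Corr hT2 hG hE hCorr V B B' m m'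
  have hb := bilinear_pathSum_le sz k hk hsz (E V B m) (E V B' m') (fun a₀ => Xl a₀ B * szc m) (fun c₀ => Xl c₀ B' * szc m')
    (hX V B m) (hX V B' m')
  have hc := gradient_pathSum_le sz g hg (Corr V B m B' m') (fun d₀ => Yl d₀ B B' * szc m * szc m') (hY V B m B' m')
  have e1 : ∑ a₀ : ι, ∑ c₀ : ι, k a₀ c₀ * (Xl a₀ B * szc m) * (Xl c₀ B' * szc m')
      = (∑ a₀ : ι, ∑ c₀ : ι, Xl a₀ B * k a₀ c₀ * Xl c₀ B') * szc m * szc m' := by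
    rw [Finset.sum_mul, Finset.sum_mul]
    refine Finset.sum_congr rfl (fun a₀ _ => ?_)
    rw [Finset.sum_mul, Finset.sum_mul]
    exact Finset.sum_congr rfl (fun c₀ _ => by ring)
  have e2 : ∑ d₀ : ι, g d₀ * (Yl d₀ B B' * szc m * szc m') = (∑ d₀ : ι, g d₀ * Yl d₀ B B') * szc m * szc m' := by
    rw [Finset.sum_mul, Finset.sum_mul]
    exact Finset.sum_congr rfl (fun d₀ _ => by ring)
  rw [e1] at hb
  rw [e2] at hc
  calc |f (T (actc (actc V B m) B' m')) - f (T (actc V B m)) - f (T (actc V B' m')) + f (T V)|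
      ≤ C * ((E V B m).map (fun a => ((E V B' m').map (fun c => k a.1 c.1 * sz a.2 * sz c.2)).sum)).sum
          + ((Corr V B m B' m').map (fun p => g p.1 * sz p.2)).sum := h
    _ ≤ C * ((∑ a₀ : ι, ∑ c₀ : ι, Xl a₀ B * k a₀ c₀ * Xl c₀ B') * szc m * szc m')
          + (∑ d₀ : ι, g d₀ * Yl d₀ B B') * szc m * szc m' := add_le_add (mul_le_mul_of_nonneg_left hb hC) hc
    _ = (C * ∑ a₀ : ι, ∑ c₀ : ι, Xl a₀ B * k a₀ c₀ * Xl c₀ B' + ∑ d₀ : ι, g d₀ * Yl d₀ B B') * szc m * szc m' := by ring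

end Summit.QuantumFields.YangMills.Theorems.OrganTangentPullbackSquare

end
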